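import Summits.Schanuel.Schanuel.Theorems.EPiSimultaneousType.Negative.LiftClause

/-!
# `EPiSimultaneousType` is implied by `KhovanskiiApproxType`: a refutation of the `(π, e)` instance
kills the general crux (negative lemma for cruxes `stmt-Schanuel-6118` / `stmt-Schanuel-6116`,
route DiophantineDichotomy)

`khovanskiiApproxType_false_of_not_epiSimultaneousType : ¬ EPiSimultaneousType → ¬ KhovanskiiApproxType`.

The route files `EPiSimultaneousType` (crux 6118, the simultaneous approximation measure for the
PAIR `(π, e) ∈ ℂ²` with degree exponent `a < 1`) as "the instance `n = 2`, `s = (1, iπ)`" of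
`KhovanskiiApproxType` (crux 6116, the measure with `a < 1/(n−1)` at every free Khovanskii point
`θ = (s, e^s) ∈ ℂ²ⁿ`). This file kernel-checks that dependency, with explicit bookkeeping:

* `s = (1, iπ)` has `ℚ`-linearly independent coordinates and is a NON-DEGENERATE zero of the
  Khovanskii system `g = (X₁ − 1, Y₂ + 1)` over `ℚ` (exponential Jacobian `det = e^{iπ} = −1 ≠ 0`);
  `θ = (1, iπ, e, −1)`.
* TRANSFER `ℂ⁴ → ℂ²` (`Negative/LiftClause.lean`): a challenger `γ = (γ₁, γ₂)` of `(π, e)`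
  admissible at level `(d, H)` yields the challenger `γ⁴ = (1, iγ₁, γ₂, −1)` of `θ` admissible at
  level `(2d, (2d+1)H²)`, with `‖γ⁴ − θ‖ ≤ ‖γ − (π, e)‖`.
* CONSTANTS: a witness `(a, b, C)` at `θ` (so `a < 1/(2−1) = 1`) gives the witness
  `(a, max(a+1, b), C(2^{|a|+1} + 2^{|b|}))` for the pair, using `log((2d+1)H²) ≤ 2d + 2 log H`.

* CONVERSE (`measureAt_one_I_pi_of_epiSimultaneousType`): the crux implies the measure of
  `KhovanskiiApproxType`'s shape AT `s = (1, iπ)` (transfer `(γ₁, γ₂, γ₃, γ₄) ↦ (−iγ₂, γ₃)`, same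
  levels and constants). So crux 6118 is EXACTLY the `(1, iπ)`-instance of crux 6116.

Consequence for the route's kill criteria: `EPiSimultaneousType` cannot be "refuted alone" — any
refutation of it refutes `KhovanskiiApproxType` (as filed, for all `n ≥ 2`) and hence breaks the
line `ApproximationRace`. Everything is proved; no named facts; cdisprove seat of crux 6118.
-/

set_option linter.dupNamespace false

noncomputable section

namespace Summit.Schanuel.Schanuel.Theorems

open Polynomial Complex
open scoped IntermediateField
open Summit.Schanuel.Schanuel.Theses.DiophantineDichotomy

namespace EPiSimultaneousType

/-! ### The free Khovanskii point `s = (1, iπ)` -/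

/-- `1, iπ` are `ℚ`-linearly independent (`iπ ∉ ℝ`). [folklore] -/
theorem linearIndependent_one_I_pi : LinearIndependent ℚ ![(1 : ℂ), I * Real.pi] := by
  rw [LinearIndependent.pair_iff]
  intro s t h
  have h1 := congrArg Complex.re h
  have h2 := congrArg Complex.im h
  simp at h1 h2
  exact ⟨h1, h2⟩

/-- `s = (1, iπ)` is a non-degenerate zero of the Khovanskii system `(X₁ − 1, Y₂ + 1)` over `ℚ`:
both equations hold at `θ = (1, iπ, e, −1)` and the exponential Jacobian is `1 · e^{iπ} = −1 ≠ 0`.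
[folklore] -/
theorem khovanskiiSystem_one_I_pi :
    ∃ g : Fin 2 → MvPolynomial (Fin 2 ⊕ Fin 2) ℚ,
      (∀ i, MvPolynomial.aeval (Sum.elim ![(1 : ℂ), I * Real.pi]
        (Complex.exp ∘ ![(1 : ℂ), I * Real.pi])) (g i) = 0) ∧
      (Matrix.of fun i j => MvPolynomial.aeval (Sum.elim ![(1 : ℂ), I * Real.pi]
        (Complex.exp ∘ ![(1 : ℂ), I * Real.pi]))
        (MvPolynomial.pderiv (Sum.inl j) (g i) +
          MvPolynomial.X (Sum.inr j) * MvPolynomial.pderiv (Sum.inr j) (g i))).det ≠ 0 := by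
  refine ⟨![MvPolynomial.X (Sum.inl 0) - 1, MvPolynomial.X (Sum.inr 1) + 1], ?_, ?_⟩
  · intro i
    fin_cases i
    · simp
    · simp
      rw [mul_comm, Complex.exp_pi_mul_I]; ring
  · rw [Matrix.det_fin_two]
    simp [MvPolynomial.pderiv_X]

/-! ### Bookkeeping shared by both directions -/

/-- The clause is stable under `γ ↦ −γ` (`P ↦ P(−X)`). [folklore] -/
theorem clause_neg {γ : ℂ} {d H : ℕ}
    (h : ∃ P : Polynomial ℤ, P ≠ 0 ∧ P.natDegree ≤ d ∧ (∀ k, |P.coeff k| ≤ (H : ℤ)) ∧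
      Polynomial.aeval γ P = 0) :
    ∃ P : Polynomial ℤ, P ≠ 0 ∧ P.natDegree ≤ d ∧ (∀ k, |P.coeff k| ≤ (H : ℤ)) ∧
      Polynomial.aeval (-γ) P = 0 := by
  obtain ⟨P, hP0, hdeg, hH, hroot⟩ := h
  refine ⟨P.comp (-X), fun h0 => hP0 (comp_neg_X_eq_zero_iff.mp h0), ?_, fun k => ?_, ?_⟩
  · rw [Polynomial.natDegree_eq_of_degree_eq degree_comp_neg_X]; exact hdeg
  · rw [coeff_comp_neg_X, abs_mul, abs_pow, abs_neg, abs_one, one_pow, one_mul]; exact hH k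
  · rw [aeval_comp]; simpa using hroot

/-- CONSTANTS OF THE TRANSFER: at level `(2d, (2d+1)H²)` the exponent of a measure `(a, b, C₀)`
is dominated by `(a, max(a+1, b), C₀(2^{|a|+1} + 2^{|b|}))` at level `(d, H)`, using
`log((2d+1)H²) ≤ 2d + 2 log H`. [folklore] -/
theorem transfer_constants {a b C0 : ℝ} (hC : 0 ≤ C0) {d H : ℕ} (hd1 : 1 ≤ d) (hH1 : 1 ≤ H) :
    C0 * ((((2 * d : ℕ) : ℝ)) ^ a * Real.log (((2 * d + 1) * H ^ 2 : ℕ) : ℝ) +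
        (((2 * d : ℕ) : ℝ)) ^ b) ≤
      C0 * (2 ^ (|a| + 1) + 2 ^ |b|) * ((d : ℝ) ^ a * Real.log H + (d : ℝ) ^ (max (a + 1) b)) := by
  set K : ℝ := 2 ^ (|a| + 1) + 2 ^ |b| with hKdef
  have hd1' : (1 : ℝ) ≤ d := by exact_mod_cast hd1
  have hd0 : (0 : ℝ) < d := by linarith
  have hH1' : (1 : ℝ) ≤ H := by exact_mod_cast hH1
  have hlog : 0 ≤ Real.log H := Real.log_nonneg hH1'
  have hcast1 : ((2 * d : ℕ) : ℝ) = 2 * d := by push_cast; ring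
  have hcast2 : (((2 * d + 1) * H ^ 2 : ℕ) : ℝ) = (2 * d + 1) * (H : ℝ) ^ 2 := by push_cast; ring
  rw [hcast1, hcast2]
  set b' := max (a + 1) b with hb'
  have h2a : (2 * (d : ℝ)) ^ a ≤ 2 ^ |a| * (d : ℝ) ^ a := by
    rw [Real.mul_rpow (by norm_num) hd0.le]
    exact mul_le_mul_of_nonneg_right
      (Real.rpow_le_rpow_of_exponent_le (by norm_num : (1 : ℝ) ≤ 2) (le_abs_self a)) (by positivity)
  have h2b : (2 * (d : ℝ)) ^ b ≤ 2 ^ |b| * (d : ℝ) ^ b' := by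
    rw [Real.mul_rpow (by norm_num) hd0.le]
    exact mul_le_mul (Real.rpow_le_rpow_of_exponent_le (by norm_num : (1 : ℝ) ≤ 2) (le_abs_self b))
      (Real.rpow_le_rpow_of_exponent_le hd1' (le_max_right _ _)) (by positivity) (by positivity)
  have hlogH' : Real.log ((2 * d + 1) * (H : ℝ) ^ 2) ≤ 2 * d + 2 * Real.log H := by
    rw [Real.log_mul (by positivity) (by positivity), Real.log_pow]
    have := Real.log_le_sub_one_of_pos (show (0 : ℝ) < 2 * d + 1 by positivity)
    push_cast at this ⊢
    linarith
  have hda1 : (d : ℝ) ^ a * d ≤ (d : ℝ) ^ b' := by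
    rw [← Real.rpow_add_one hd0.ne']
    exact Real.rpow_le_rpow_of_exponent_le hd1' (le_max_left _ _)
  have hpos1 : 0 ≤ (d : ℝ) ^ a := by positivity
  have hpos2 : 0 ≤ (d : ℝ) ^ b' := by positivity
  have key : (2 * (d : ℝ)) ^ a * Real.log ((2 * d + 1) * (H : ℝ) ^ 2) + (2 * (d : ℝ)) ^ b ≤
      K * ((d : ℝ) ^ a * Real.log H + (d : ℝ) ^ b') := by
    have hlogH'0 : 0 ≤ Real.log ((2 * d + 1) * (H : ℝ) ^ 2) :=
      Real.log_nonneg (by nlinarith)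
    calc (2 * (d : ℝ)) ^ a * Real.log ((2 * d + 1) * (H : ℝ) ^ 2) + (2 * (d : ℝ)) ^ b
        ≤ (2 ^ |a| * (d : ℝ) ^ a) * (2 * d + 2 * Real.log H) + 2 ^ |b| * (d : ℝ) ^ b' := by
          gcongr
      _ = 2 * 2 ^ |a| * ((d : ℝ) ^ a * Real.log H) + 2 * 2 ^ |a| * ((d : ℝ) ^ a * d) +
            2 ^ |b| * (d : ℝ) ^ b' := by ring
      _ ≤ 2 * 2 ^ |a| * ((d : ℝ) ^ a * Real.log H) + 2 * 2 ^ |a| * (d : ℝ) ^ b' +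
            2 ^ |b| * (d : ℝ) ^ b' := by gcongr
      _ = 2 ^ (|a| + 1) * ((d : ℝ) ^ a * Real.log H) + (2 ^ (|a| + 1) + 2 ^ |b|) * (d : ℝ) ^ b' := by
          rw [Real.rpow_add_one (by norm_num : (2 : ℝ) ≠ 0)]; ring
      _ ≤ K * ((d : ℝ) ^ a * Real.log H) + K * (d : ℝ) ^ b' := by
          have hKge : (2 : ℝ) ^ (|a| + 1) ≤ K := by rw [hKdef]; exact le_add_of_nonneg_right (by positivity)
          exact add_le_add (mul_le_mul_of_nonneg_right hKge (mul_nonneg hpos1 hlog))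
            (le_of_eq (by rw [hKdef]))
      _ = K * ((d : ℝ) ^ a * Real.log H + (d : ℝ) ^ b') := by ring
  calc C0 * ((2 * (d : ℝ)) ^ a * Real.log ((2 * d + 1) * (H : ℝ) ^ 2) + (2 * (d : ℝ)) ^ b)
      ≤ C0 * (K * ((d : ℝ) ^ a * Real.log H + (d : ℝ) ^ b')) := by gcongr
    _ = C0 * K * ((d : ℝ) ^ a * Real.log H + (d : ℝ) ^ b') := by ring

/-- A level `H' = (2d+1)H²` dominates `H` and `1` when `d, H ≥ 1`. [folklore] -/
theorem height_lift_le {d H : ℕ} (hH1 : 1 ≤ H) :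
    (H : ℤ) ≤ (((2 * d + 1) * H ^ 2 : ℕ) : ℤ) ∧ (1 : ℤ) ≤ (2 * (d : ℤ) + 1) * (H : ℤ) ^ 2 := by
  have hH' : (H : ℤ) ≤ (((2 * d + 1) * H ^ 2 : ℕ) : ℤ) := by
    push_cast
    have : (H : ℤ) * 1 ≤ H * H := mul_le_mul_of_nonneg_left (by exact_mod_cast hH1) (by positivity)
    nlinarith
  refine ⟨hH', ?_⟩
  have h1' : (1 : ℤ) ≤ (((2 * d + 1) * H ^ 2 : ℕ) : ℤ) := le_trans (by exact_mod_cast hH1) hH'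
  push_cast at h1'
  exact h1'

/-- FIELD DEGREE OF THE DESCENT: `[ℚ(−iγ₂, γ₃):ℚ] ≤ 2·[ℚ(γ₁, γ₂, γ₃, γ₄):ℚ]` for algebraic `γᵢ`.
[folklore] -/
theorem finrank_descent_le (γ : Fin 2 ⊕ Fin 2 → ℂ) (hint : ∀ i, IsIntegral ℚ (γ i)) :
    Module.finrank ℚ ↥(IntermediateField.adjoin ℚ
        (Set.range ![-I * γ (Sum.inl 1), γ (Sum.inr 0)])) ≤
      2 * Module.finrank ℚ ↥(IntermediateField.adjoin ℚ (Set.range γ)) := by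
  set K1 := IntermediateField.adjoin ℚ (Set.range γ) with hK1
  set K2 : IntermediateField ℚ ℂ := ℚ⟮I⟯ with hK2
  haveI : Finite (Set.range γ) := Set.finite_range γ |>.to_subtype
  haveI : FiniteDimensional ℚ K1 :=
    IntermediateField.finiteDimensional_adjoin (fun x hx => by
      obtain ⟨i, rfl⟩ := hx; exact hint i)
  haveI : FiniteDimensional ℚ K2 := IntermediateField.adjoin.finiteDimensional isIntegral_I
  have hle : IntermediateField.adjoin ℚ (Set.range ![-I * γ (Sum.inl 1), γ (Sum.inr 0)]) ≤
      K1 ⊔ K2 := by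
    rw [IntermediateField.adjoin_le_iff]
    rintro _ ⟨i, rfl⟩
    have hγ : ∀ j, γ j ∈ K1 ⊔ K2 := fun j =>
      (le_sup_left : K1 ≤ K1 ⊔ K2) (IntermediateField.subset_adjoin ℚ _ ⟨j, rfl⟩)
    have hI : I ∈ K1 ⊔ K2 :=
      (le_sup_right : K2 ≤ K1 ⊔ K2) (IntermediateField.mem_adjoin_simple_self ℚ I)
    fin_cases i
    · exact mul_mem (neg_mem hI) (hγ (Sum.inl 1))
    · exact hγ (Sum.inr 0)
  calc Module.finrank ℚ ↥(IntermediateField.adjoin ℚ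
          (Set.range ![-I * γ (Sum.inl 1), γ (Sum.inr 0)]))
      ≤ Module.finrank ℚ ↥(K1 ⊔ K2) := IntermediateField.finrank_le_of_le_right hle
    _ ≤ Module.finrank ℚ K1 * Module.finrank ℚ K2 := IntermediateField.finrank_sup_le K1 K2
    _ ≤ Module.finrank ℚ K1 * 2 := Nat.mul_le_mul_left _ finrank_adjoin_I_le
    _ = 2 * Module.finrank ℚ K1 := by ring

end EPiSimultaneousType

open EPiSimultaneousType

/-- **`KhovanskiiApproxType` (crux 6116) implies `EPiSimultaneousType` (crux 6118)**, stated
negatively: a refutation of the `(π, e)`-instance refutes the general crux. Transfer: a challenger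
`(γ₁, γ₂)` of `(π, e)` at level `(d, H)` lifts to the challenger `(1, iγ₁, γ₂, −1)` of
`θ = (1, iπ, e, −1)` at level `(2d, (2d+1)H²)` with the same sup-distance; a witness `(a, b, C)` at
`θ` gives `(a, max(a+1, b), C(2^{|a|+1} + 2^{|b|}))` for the pair. [folklore] -/
theorem khovanskiiApproxType_false_of_not_epiSimultaneousType (hne : ¬ EPiSimultaneousType) :
    ¬ KhovanskiiApproxType := by
  intro hK
  apply hne
  obtain ⟨a, b, C0, ha, hC, hM⟩ :=
    hK 2 ![(1 : ℂ), I * Real.pi] le_rfl linearIndependent_one_I_pi khovanskiiSystem_one_I_pi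
  have ha1 : a < 1 := by norm_num at ha; exact ha
  refine ⟨a, max (a + 1) b, C0 * (2 ^ (|a| + 1) + 2 ^ |b|), ha1, by positivity, ?_⟩
  intro d H γ hfin hcl
  obtain ⟨hd1, hH1⟩ := one_le_of_clause' (hcl 0)
  obtain ⟨hH', h1''⟩ := height_lift_le (d := d) hH1
  -- the lifted challenger
  set γ4 : Fin 2 ⊕ Fin 2 → ℂ := Sum.elim ![(1 : ℂ), I * γ 0] ![γ 1, -1] with hγ4
  have hfin4 : Module.finrank ℚ ↥(IntermediateField.adjoin ℚ (Set.range γ4)) ≤ 2 * d :=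
    (finrank_lift_le γ (fun i => isIntegral_of_clause (hcl i))).trans (Nat.mul_le_mul_left 2 hfin)
  have hcl4 : ∀ i, ∃ P : Polynomial ℤ, P ≠ 0 ∧ P.natDegree ≤ 2 * d ∧
      (∀ k, |P.coeff k| ≤ (((2 * d + 1) * H ^ 2 : ℕ) : ℤ)) ∧ Polynomial.aeval (γ4 i) P = 0 := by
    rintro (i | i) <;> fin_cases i
    · refine ⟨X - C 1, X_sub_C_ne_zero 1, by rw [natDegree_X_sub_C]; omega, fun k => ?_, by simp [hγ4]⟩
      rw [coeff_sub, coeff_X, coeff_C]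
      rcases k with _ | _ | k
      · simpa using h1''
      · simpa using h1''
      · simp
    · simpa [hγ4] using clause_I_mul (hcl 0)
    · obtain ⟨P, hP0, hdeg, hHt, hroot⟩ := hcl 1
      exact ⟨P, hP0, by omega, fun k => (hHt k).trans hH', by simpa [hγ4] using hroot⟩
    · refine ⟨X + C 1, X_add_C_ne_zero 1, by rw [natDegree_X_add_C]; omega, fun k => ?_, by simp [hγ4]⟩
      rw [coeff_add, coeff_X, coeff_C]
      rcases k with _ | _ | k
      · simpa using h1''
      · simpa using h1''
      · simp
  have hmeas := hM (2 * d) ((2 * d + 1) * H ^ 2) γ4 hfin4 hcl4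
  have hdist : ‖γ4 - Sum.elim ![(1 : ℂ), I * Real.pi] (Complex.exp ∘ ![(1 : ℂ), I * Real.pi])‖ ≤
      ‖γ - ![(Real.pi : ℂ), (Real.exp 1 : ℂ)]‖ := by
    rw [pi_norm_le_iff_of_nonneg (norm_nonneg _)]
    rintro (i | i) <;> fin_cases i
    · simp [hγ4]
    · have := norm_le_pi_norm (γ - ![(Real.pi : ℂ), (Real.exp 1 : ℂ)]) 0
      simpa [hγ4, ← mul_sub, norm_mul] using this
    · have := norm_le_pi_norm (γ - ![(Real.pi : ℂ), (Real.exp 1 : ℂ)]) 1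
      simpa [hγ4, Complex.ofReal_exp] using this
    · simp [hγ4]
      rw [mul_comm, Complex.exp_pi_mul_I]; simp
  refine le_trans ?_ (hmeas.trans hdist)
  rw [Real.exp_le_exp, neg_le_neg_iff]
  exact transfer_constants hC.le hd1 hH1

/-- **Converse: `EPiSimultaneousType` is exactly the `s = (1, iπ)` instance** — the crux implies
the measure of `KhovanskiiApproxType`'s shape at `θ = (1, iπ, e, −1)` (descent of challengers
`(γ₁, γ₂, γ₃, γ₄) ↦ (−iγ₂, γ₃)` at level `(2d, (2d+1)H²)`, same constants as above). Together with
the previous theorem: crux 6118 ⟺ the `(1, iπ)`-instance of crux 6116. [folklore] -/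
theorem measureAt_one_I_pi_of_epiSimultaneousType (h : EPiSimultaneousType) :
    ∃ a b C : ℝ, a < 1 ∧ 0 < C ∧ ∀ (d H : ℕ) (γ : Fin 2 ⊕ Fin 2 → ℂ),
      Module.finrank ℚ ↥(IntermediateField.adjoin ℚ (Set.range γ)) ≤ d →
      (∀ i, ∃ P : Polynomial ℤ, P ≠ 0 ∧ P.natDegree ≤ d ∧ (∀ k, |P.coeff k| ≤ (H : ℤ)) ∧
        Polynomial.aeval (γ i) P = 0) →
      Real.exp (-(C * ((d : ℝ) ^ a * Real.log H + (d : ℝ) ^ b))) ≤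
        ‖γ - Sum.elim ![(1 : ℂ), I * Real.pi] (Complex.exp ∘ ![(1 : ℂ), I * Real.pi])‖ := by
  obtain ⟨a, b, C0, ha, hC, hM⟩ := h
  refine ⟨a, max (a + 1) b, C0 * (2 ^ (|a| + 1) + 2 ^ |b|), ha, by positivity, ?_⟩
  intro d H γ hfin hcl
  obtain ⟨hd1, hH1⟩ := one_le_of_clause' (hcl (Sum.inl 0))
  obtain ⟨hH', -⟩ := height_lift_le (d := d) hH1
  -- the descended challenger
  set p : Fin 2 → ℂ := ![-I * γ (Sum.inl 1), γ (Sum.inr 0)] with hp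
  have hfinp : Module.finrank ℚ ↥(IntermediateField.adjoin ℚ (Set.range p)) ≤ 2 * d :=
    (finrank_descent_le γ (fun i => isIntegral_of_clause (hcl i))).trans (Nat.mul_le_mul_left 2 hfin)
  have hclp : ∀ i, ∃ P : Polynomial ℤ, P ≠ 0 ∧ P.natDegree ≤ 2 * d ∧
      (∀ k, |P.coeff k| ≤ (((2 * d + 1) * H ^ 2 : ℕ) : ℤ)) ∧ Polynomial.aeval (p i) P = 0 := by
    intro i
    fin_cases i
    · have := clause_I_mul (clause_neg (hcl (Sum.inl 1)))
      simpa [hp] using this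
    · obtain ⟨P, hP0, hdeg, hHt, hroot⟩ := hcl (Sum.inr 0)
      exact ⟨P, hP0, by omega, fun k => (hHt k).trans hH', by simpa [hp] using hroot⟩
  have hmeas := hM (2 * d) ((2 * d + 1) * H ^ 2) p hfinp hclp
  have hdist : ‖p - ![(Real.pi : ℂ), (Real.exp 1 : ℂ)]‖ ≤
      ‖γ - Sum.elim ![(1 : ℂ), I * Real.pi] (Complex.exp ∘ ![(1 : ℂ), I * Real.pi])‖ := by
    rw [pi_norm_le_iff_of_nonneg (norm_nonneg _)]
    intro i
    fin_cases i
    · show ‖(p - ![(Real.pi : ℂ), (Real.exp 1 : ℂ)]) 0‖ ≤ _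
      have := norm_le_pi_norm
        (γ - Sum.elim ![(1 : ℂ), I * Real.pi] (Complex.exp ∘ ![(1 : ℂ), I * Real.pi])) (Sum.inl 1)
      have e : (p - ![(Real.pi : ℂ), (Real.exp 1 : ℂ)]) 0 = -I * ((γ - Sum.elim ![(1 : ℂ), I * Real.pi]
          (Complex.exp ∘ ![(1 : ℂ), I * Real.pi])) (Sum.inl 1)) := by
        simp only [hp, Pi.sub_apply, Sum.elim_inl, Matrix.cons_val_zero, Matrix.cons_val_one,
          Matrix.cons_val_fin_one]
        ring_nf
        rw [Complex.I_sq]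
        ring
      rw [e, norm_mul]
      simpa using this
    · have := norm_le_pi_norm
        (γ - Sum.elim ![(1 : ℂ), I * Real.pi] (Complex.exp ∘ ![(1 : ℂ), I * Real.pi])) (Sum.inr 0)
      simpa [hp, Complex.ofReal_exp] using this
  refine le_trans ?_ (hmeas.trans hdist)
  rw [Real.exp_le_exp, neg_le_neg_iff]
  exact transfer_constants hC.le hd1 hH1

end Summit.Schanuel.Schanuel.Theorems

end
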